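import Summits.BirchSwinnertonDyer.BirchSwinnertonDyer.Theorems.ManinLocalTwoThreeRootFormsEighty
import Summits.BirchSwinnertonDyer.BirchSwinnertonDyer.Theorems.ManinLocalTwoThreeEvenCoeffVanishing
import Summits.BirchSwinnertonDyer.BirchSwinnertonDyer.Theorems.ByReductionTypeAtTwoAdditivePotGoodPrintShuZhai80b1Base
import Summits.BirchSwinnertonDyer.BirchSwinnertonDyer.Theorems.Rank1ResidualIntModelReduction
import Literature.NumberTheory.EllipticCurves.ModularCurveNeronLatticeProofs
import HarnessLib

/-!
# The level-80 ROOT FORMS `φ₈₀ₐ`, `φ₈₀ᵦ`: parity `a₂ₖ = 0`, Néron lattices of `80a1` / `80b1` with the squeeze, multiplicativity at `5`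

Cell bsd-f2-manin, route `ManinLocalTwoThree` (crux C2 `ManinOddAtFour`, stmt-BirchSwinnertonDyer-22967; `--supports` helper), LEAD p1 gen 27.
Bookkeeping that turns LEAD g26's datum-free root terms `RootFormsEighty.phiEightyA/B` (tables `tEightyA/B` to depth `145`, squeezes
`periodLattice_le_phiEightyA/B (L₀) (hL₀)`) into the exact hypothesis packages of the two transport engines used at the levels pinned today
(an g57: `320 = 2⁶·5`, `400 = 2⁴·5²`):

* §1 **`cuspCoeff_even_phiEightyA/B : ∀ n, 2 ∣ n → aₙ(φ₈₀ₓ) = 0`** — the `heven` input of desc's two-twist ALIGNED transport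
  (`TwistDefect.abs_maninConstant_eq_one_of_squeeze_twoTwist_aligned_level`, rows `320 ∋ 80b ⊗ χ₈, 80b ⊗ χ₈′`): LEAD g26's `U₂`–Sturm tool
  `EvenCoeffVanishing.cuspCoeff_even_eq_zero_of_table` on `Γ₀(80)` (`μ = 144`, weight-2 Sturm bound `24`, table depth `145 ≥ 2·25 − 1`).
* §2 **`exists_neron_squeeze_phiEightyA/B : ∃ L₀, IsNeronLatticeOf (80x1/ℂ) L₀ ∧ Λ(φ₈₀ₓ) ⊆ Λ(L₀)`** — uniformisation
  (`exists_isNeronLatticeOf_holds`) + the landed squeezes; the `(L₀, hL₀, hS0)` triple of both engines.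
* §3 **`hasMultiplicativeReductionAtPrime_five_eightyA1/B1`** (`5 ∥ Δ = ±6400`, `5 ∤ c₄ = 336 / −176`) — the `hsemi` input of p3's
  odd-twist ROOT-FORM transport at `p = 5` (`OddTwistRootForm.abs_maninConstant_eq_one_of_rootForm_charTwist_eq`, rows `400 ∋ 80a ⊗ χ₅, 80b ⊗ χ₅`).

HONEST FRAMING: unconditional (standard axioms); bookkeeping only; nothing here proves C2/C3, Manin's conjecture or BSD.  No `Prop` definition,
no named fact, no sorry. [cite: Sturm1987, Thm. 1] [cite: SilvermanAEC2009, Thm. VI.5.1, VII.5 Prop. 5.1(b)] [cite: CremonaAlgorithms1997, §2.10, Table 1 (80a1, 80b1)]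
-/

set_option autoImplicit false
-- lint-debt: the directory name repeats the summit name (sibling precedent `ManinLocalTwoThreeRootFormsEighty.lean`)
set_option linter.dupNamespace false

noncomputable section

open Complex
open UpperHalfPlane hiding I
open scoped MatrixGroups ModularForm
open ModularForm CongruenceSubgroup PowerSeries
open Literature.NumberTheory.ModularForms
open Literature.NumberTheory.EllipticCurves Literature.NumberTheory.EllipticCurves.ModularForms

namespace Summit.BirchSwinnertonDyer.BirchSwinnertonDyer.Theorems.ManinLocalTwoThree.RootFormsEighty

open Summit.BirchSwinnertonDyer.BirchSwinnertonDyer.Theorems.ManinLocalTwoThree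
open Summit.BirchSwinnertonDyer.BirchSwinnertonDyer.Theorems
open Summit.BirchSwinnertonDyer.BirchSwinnertonDyer.Rank1Residual.IntModel
open BracketSturm LevelEighty EvenCoeffVanishing

set_option maxHeartbeats 4000000
set_option maxRecDepth 16384

/-! ## §1 Parity: `a₂ₖ(φ₈₀ₐ) = a₂ₖ(φ₈₀ᵦ) = 0` -/

/-- The even entries of `tEightyA` below `50` vanish. [folklore] -/
theorem tEightyA_even_eq_zero : ∀ n < 25, tEightyA.getD (2 * n) 0 = 0 := by
  decide

/-- The even entries of `tEightyB` below `50` vanish. [folklore] -/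
theorem tEightyB_even_eq_zero : ∀ n < 25, tEightyB.getD (2 * n) 0 = 0 := by
  decide

/-- **`a₂ₖ(φ₈₀ₐ) = 0` for every `k`**: `U₂ φ₈₀ₐ ∈ S₂(Γ₀(80))` has coefficients `a₂ₙ`, zero for `n < 25` by the table, hence
`U₂ φ₈₀ₐ = 0` by Sturm (`⌊2·144/12⌋ = 24`). [cite: Sturm1987, Thm. 1] -/
theorem cuspCoeff_even_phiEightyA : ∀ n : ℕ, 2 ∣ n → cuspCoeff phiEightyA n = 0 :=
  cuspCoeff_even_eq_zero_of_table (by norm_num) phiEightyA (m := 25) (K := 145) (by rw [gamma0Index_eighty]; decide) (by norm_num)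
    tEightyA tEightyA_eq_cuspCoeff tEightyA_even_eq_zero

/-- **`a₂ₖ(φ₈₀ᵦ) = 0` for every `k`** (same argument). [cite: Sturm1987, Thm. 1] -/
theorem cuspCoeff_even_phiEightyB : ∀ n : ℕ, 2 ∣ n → cuspCoeff phiEightyB n = 0 :=
  cuspCoeff_even_eq_zero_of_table (by norm_num) phiEightyB (m := 25) (K := 145) (by rw [gamma0Index_eighty]; decide) (by norm_num)
    tEightyB tEightyB_eq_cuspCoeff tEightyB_even_eq_zero

/-! ## §2 Néron lattices of the root curves and the squeezes -/

/-- **`∃ L₀`, a Néron period pair of `80a1 = [0, 0, 0, −7, 6]`, with `Λ(φ₈₀ₐ) ⊆ Λ(L₀)`** (uniformisation + LEAD g26's squeeze).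
[cite: SilvermanAEC2009, Thm. VI.5.1] [cite: CremonaAlgorithms1997, §2.10, Table 1 (80a1)] -/
theorem exists_neron_squeeze_phiEightyA : ∃ L₀ : PeriodPair,
    IsNeronLatticeOf ((⟨0, 0, 0, -7, 6⟩ : WeierstrassCurve ℚ).baseChange ℂ) L₀ ∧ ∀ z ∈ periodLattice phiEightyA, z ∈ L₀.lattice := by
  haveI := isElliptic_eightyA1
  obtain ⟨L₀, hL₀⟩ := exists_isNeronLatticeOf_holds ((⟨0, 0, 0, -7, 6⟩ : WeierstrassCurve ℚ).baseChange ℂ)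
  exact ⟨L₀, hL₀, periodLattice_le_phiEightyA L₀ hL₀⟩

/-- **`∃ L₀`, a Néron period pair of `80b1 = [0, −1, 0, 4, −4]`, with `Λ(φ₈₀ᵦ) ⊆ Λ(L₀)`.**
[cite: SilvermanAEC2009, Thm. VI.5.1] [cite: CremonaAlgorithms1997, §2.10, Table 1 (80b1)] -/
theorem exists_neron_squeeze_phiEightyB : ∃ L₀ : PeriodPair,
    IsNeronLatticeOf ((⟨0, -1, 0, 4, -4⟩ : WeierstrassCurve ℚ).baseChange ℂ) L₀ ∧ ∀ z ∈ periodLattice phiEightyB, z ∈ L₀.lattice := by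
  haveI := AddPotGoodPrint.isElliptic_80b1
  obtain ⟨L₀, hL₀⟩ := exists_isNeronLatticeOf_holds ((⟨0, -1, 0, 4, -4⟩ : WeierstrassCurve ℚ).baseChange ℂ)
  exact ⟨L₀, hL₀, periodLattice_le_phiEightyB L₀ hL₀⟩

/-! ## §3 The root curves are multiplicative at `5` -/

/-- The tree's integral model of `80a1` is `[0, 0, 0, −7, 6]`. [folklore] -/
theorem integralModelInt_eightyA1 [(⟨0, 0, 0, -7, 6⟩ : WeierstrassCurve ℚ).IsGloballyMinimal] :
    WeierstrassCurve.integralModelInt (⟨0, 0, 0, -7, 6⟩ : WeierstrassCurve ℚ) = ⟨0, 0, 0, -7, 6⟩ :=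
  integralModelInt_eq_of_map_eq _ ((map_mk_int 0 0 0 (-7) 6).trans mk_eightyA1_eq_cast.symm)

/-- The tree's integral model of `80b1` is `[0, −1, 0, 4, −4]`. [folklore] -/
theorem integralModelInt_eightyB1 [(⟨0, -1, 0, 4, -4⟩ : WeierstrassCurve ℚ).IsGloballyMinimal] :
    WeierstrassCurve.integralModelInt (⟨0, -1, 0, 4, -4⟩ : WeierstrassCurve ℚ) = ⟨0, -1, 0, 4, -4⟩ :=
  integralModelInt_eq_of_map_eq _ ((map_mk_int 0 (-1) 0 4 (-4)).trans mk_eightyB1_eq_cast.symm)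

/-- **`80a1` has multiplicative reduction at `5`** (`5 ∣ Δ = 6400 = 2⁸·5²`, `5 ∤ c₄ = 336`).
[cite: SilvermanAEC2009, VII.5 Prop. 5.1(b)] [cite: CremonaAlgorithms1997, Table 1 (80a1)] -/
theorem hasMultiplicativeReductionAtPrime_five_eightyA1 [Fact (Nat.Prime 5)] :
    (⟨0, 0, 0, -7, 6⟩ : WeierstrassCurve ℚ).HasMultiplicativeReductionAtPrime 5 := by
  haveI := isElliptic_eightyA1
  haveI := isGloballyMinimal_eightyA1
  exact hasMultiplicativeReductionAtPrime_of_intModel (W := (⟨0, 0, 0, -7, 6⟩ : WeierstrassCurve ℚ))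
    integralModelInt_eightyA1 5 (by decide) (by decide)

/-- **`80b1` has multiplicative reduction at `5`** (`5 ∣ Δ = −6400`, `5 ∤ c₄ = −176`).
[cite: SilvermanAEC2009, VII.5 Prop. 5.1(b)] [cite: CremonaAlgorithms1997, Table 1 (80b1)] -/
theorem hasMultiplicativeReductionAtPrime_five_eightyB1 [Fact (Nat.Prime 5)] :
    (⟨0, -1, 0, 4, -4⟩ : WeierstrassCurve ℚ).HasMultiplicativeReductionAtPrime 5 := by
  haveI := AddPotGoodPrint.isElliptic_80b1
  haveI := AddPotGoodPrint.isGloballyMinimal_80b1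
  exact hasMultiplicativeReductionAtPrime_of_intModel (W := (⟨0, -1, 0, 4, -4⟩ : WeierstrassCurve ℚ))
    integralModelInt_eightyB1 5 (by decide) (by decide)

end Summit.BirchSwinnertonDyer.BirchSwinnertonDyer.Theorems.ManinLocalTwoThree.RootFormsEighty

end
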